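import Summits.CriticalPhenomena.PercolationContinuityZ3.Theorems.PercNearOneGluingNoHeavyLowerTailAntitheticTermOne
import Mathlib.Combinatorics.SetFamily.FourFunctions
import Mathlib.Data.Finset.Interval
import HarnessLib

/-!
# `NoHeavyLowerTail` (stmt-CriticalPhenomena-4575) — antithetic cluster pairs: THE FAN IS R-ASSOCIATED (hypothesis (H2) of the
# two-stage Harris THEOREM 2H for `G₂ = s * K_{1,k}` at its hub; HOME/THEOREM-FAT.md, prim-hp-2 gen 59)

Support file (`--supports stmt-CriticalPhenomena-4575`, prover `prim-hp-2`, gen 59).  No definitions, no named facts, no sorries.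
The `k`-fan at `s` with hub `z`, leaves `L`: `E₂ = {sz} ∪ {sℓ, zℓ : ℓ ∈ L}`; `X T = openCluster (T ∩ E₂) s`, `Y T = openCluster (Tᶜ ∩ E₂) s`,
`U = {T : z ∉ Y T}` (`T : Set (Sym2 V)`, pairs outside `E₂` irrelevant).  `Fan.not_mem_Y_iff`: `z ∉ Y T ↔ sz ∈ T ∧ ∀ ℓ, sℓ ∈ T ∨ zℓ ∈ T`;
`Fan.X_eq`/`Y_eq`: on `U`, `X T = {s,z} ∪ L` and `Y T = {s} ∪ {ℓ : sℓ ∉ T}`; `Fan.fibre_card`/`sum_U_eq`: `Σ_{T ∈ U} φ(B T) =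
Σ_{B ⊆ L} 2^{N−|B|−(|L|+1)} φ(B)` (`Finset.card_Icc_finset`); `fkg_real(_antitone)`: Mathlib's `fkg` without sign conditions;
**`Antithetic.TwoStage.Fan.R_associated`**: Harris' inequality on `U` for twisted-monotone functions of `(X T, Y T)` — hypothesis `hR` of
`Antithetic.TwoStage.inner_bound` / `change_nonneg`; with the nested-up property of fans this makes THEOREM FAT a tree theorem.
[cite: VandenbergHaggstromKahn2005, §1 p. 6 ("Harris' inequality"), §1 p. 3 (open cluster `C_s`)]
-/

noncomputable section
namespace Summit.CriticalPhenomena.PercolationContinuityZ3.Theorems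
open Literature.Probability.Percolation
open scoped Classical
namespace Antithetic
namespace TwoStage
namespace Fan
variable {V : Type*}

/-- An open cluster is contained in every adjacency-closed set containing its root (walk induction). [folklore] -/
theorem cluster_subset_of_closed {ω : Set (Sym2 V)} {a : V} {S : Set V} (ha : a ∈ S)
    (hcl : ∀ u w, u ∈ S → (openGraph ω).Adj u w → w ∈ S) : openCluster ω a ⊆ S := by
  intro u hu
  obtain ⟨p⟩ := (show (openGraph ω).Reachable a u from hu)
  induction p with
  | nil => exact ha
  | cons hadj _ ih => exact ih (hcl _ _ ha hadj) (SimpleGraph.Walk.reachable ‹_›)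

section Setting

variable (E₂ : Set (Sym2 V)) (s z : V) (L : Finset V) (hsz : s ≠ z) (hsL : s ∉ L) (hzL : z ∉ L)
  (hE₂ : ∀ e, e ∈ E₂ ↔ e = s(s, z) ∨ ∃ ℓ ∈ L, e = s(s, ℓ) ∨ e = s(z, ℓ))
include hsz hsL hzL hE₂

/-- The set `{s} ∪ {ℓ ∈ L : sℓ ∉ T}` is closed under blue adjacency once `sz ∈ T` and every leaf has a red edge. [this work] -/
theorem blue_closed (T : Set (Sym2 V)) (hsz' : s(s, z) ∈ T) (hL : ∀ ℓ ∈ L, s(s, ℓ) ∈ T ∨ s(z, ℓ) ∈ T) (u w : V)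
    (hu : u = s ∨ (u ∈ L ∧ s(s, u) ∉ T)) (huw : (openGraph (Tᶜ ∩ E₂)).Adj u w) : w = s ∨ (w ∈ L ∧ s(s, w) ∉ T) := by
  rw [openGraph_adj] at huw
  obtain ⟨⟨hT, hE⟩, _⟩ := huw
  rcases (hE₂ _).1 hE with h | ⟨ℓ, hℓ, h | h⟩
  · exact absurd hsz' (by rw [← h]; exact hT)
  · rw [Sym2.eq_iff] at h
    rcases h with ⟨rfl, rfl⟩ | ⟨rfl, rfl⟩
    · exact Or.inr ⟨hℓ, hT⟩
    · exact Or.inl rfl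
  · rw [Sym2.eq_iff] at h
    rcases h with ⟨rfl, rfl⟩ | ⟨rfl, rfl⟩
    · rcases hu with h | h
      · exact absurd h hsz.symm
      · exact absurd h.1 hzL
    · rcases hu with h | h
      · exact absurd h (fun h' => hsL (h' ▸ hℓ))
      · rcases hL u hℓ with h' | h'
        · exact absurd h' h.2
        · exact absurd (by rw [Sym2.eq_swap]; exact h') hT

/-- **Membership in `U`.**  `z ∉ Y T ↔ sz ∈ T ∧ ∀ ℓ ∈ L, sℓ ∈ T ∨ zℓ ∈ T`. [this work] -/
theorem not_mem_Y_iff (T : Set (Sym2 V)) :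
    z ∉ openCluster (Tᶜ ∩ E₂) s ↔ (s(s, z) ∈ T ∧ ∀ ℓ ∈ L, s(s, ℓ) ∈ T ∨ s(z, ℓ) ∈ T) := by
  constructor
  · intro hz
    refine ⟨?_, fun ℓ hℓ => ?_⟩
    · by_contra h
      exact hz (show (openGraph (Tᶜ ∩ E₂)).Adj s z by rw [openGraph_adj]; exact ⟨⟨h, (hE₂ _).2 (Or.inl rfl)⟩, hsz⟩).reachable
    · by_contra h
      rw [not_or] at h
      have h1 : (openGraph (Tᶜ ∩ E₂)).Adj s ℓ := by
        rw [openGraph_adj]; exact ⟨⟨h.1, (hE₂ _).2 (Or.inr ⟨ℓ, hℓ, Or.inl rfl⟩)⟩, fun h' => hsL (h' ▸ hℓ)⟩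
      have h2 : (openGraph (Tᶜ ∩ E₂)).Adj ℓ z := by
        rw [openGraph_adj, Sym2.eq_swap]; exact ⟨⟨h.2, (hE₂ _).2 (Or.inr ⟨ℓ, hℓ, Or.inr rfl⟩)⟩, fun h' => hzL (h'.symm ▸ hℓ)⟩
      exact hz (h1.reachable.trans h2.reachable)
  · rintro ⟨hsz', hL⟩ hz
    rcases cluster_subset_of_closed (S := {v | v = s ∨ (v ∈ L ∧ s(s, v) ∉ T)}) (Or.inl rfl)
      (blue_closed E₂ s z L hsz hsL hzL hE₂ T hsz' hL) hz with h | h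
    · exact hsz h.symm
    · exact hzL h.1

/-- On `U` the blue cluster is `{s} ∪ {ℓ ∈ L : sℓ ∉ T}`. [this work] -/
theorem Y_eq (T : Set (Sym2 V)) (hT : z ∉ openCluster (Tᶜ ∩ E₂) s) :
    openCluster (Tᶜ ∩ E₂) s = {v | v = s ∨ (v ∈ L ∧ s(s, v) ∉ T)} := by
  obtain ⟨hsz', hL⟩ := (not_mem_Y_iff E₂ s z L hsz hsL hzL hE₂ T).1 hT
  apply Set.Subset.antisymm
  · exact cluster_subset_of_closed (S := {v | v = s ∨ (v ∈ L ∧ s(s, v) ∉ T)}) (Or.inl rfl) (blue_closed E₂ s z L hsz hsL hzL hE₂ T hsz' hL)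
  · rintro v (rfl | ⟨hv, hvT⟩)
    · exact mem_openCluster_self _ _
    · exact (show (openGraph (Tᶜ ∩ E₂)).Adj s v by
        rw [openGraph_adj]; exact ⟨⟨hvT, (hE₂ _).2 (Or.inr ⟨v, hv, Or.inl rfl⟩)⟩, fun h' => hsL (h' ▸ hv)⟩).reachable

/-- On `U` the red cluster is all of `{s, z} ∪ L`. [this work] -/
theorem X_eq (T : Set (Sym2 V)) (hT : z ∉ openCluster (Tᶜ ∩ E₂) s) :
    openCluster (T ∩ E₂) s = {v | v = s ∨ v = z ∨ v ∈ L} := by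
  obtain ⟨hsz', hL⟩ := (not_mem_Y_iff E₂ s z L hsz hsL hzL hE₂ T).1 hT
  apply Set.Subset.antisymm
  · refine cluster_subset_of_closed (S := {v | v = s ∨ v = z ∨ v ∈ L}) (Or.inl rfl) (fun u w _ huw => ?_)
    rw [openGraph_adj] at huw
    rcases (hE₂ _).1 huw.1.2 with h | ⟨ℓ, hℓ, h | h⟩ <;> rw [Sym2.eq_iff] at h <;> rcases h with ⟨_, rfl⟩ | ⟨_, rfl⟩
    exacts [Or.inr (Or.inl rfl), Or.inl rfl, Or.inr (Or.inr hℓ), Or.inl rfl, Or.inr (Or.inr hℓ), Or.inr (Or.inl rfl)]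
  · have hz' : z ∈ openCluster (T ∩ E₂) s :=
      (show (openGraph (T ∩ E₂)).Adj s z by rw [openGraph_adj]; exact ⟨⟨hsz', (hE₂ _).2 (Or.inl rfl)⟩, hsz⟩).reachable
    rintro v (rfl | rfl | hv)
    · exact mem_openCluster_self _ _
    · exact hz'
    · rcases hL v hv with h | h
      · exact (show (openGraph (T ∩ E₂)).Adj s v by
          rw [openGraph_adj]; exact ⟨⟨h, (hE₂ _).2 (Or.inr ⟨v, hv, Or.inl rfl⟩)⟩, fun h' => hsL (h' ▸ hv)⟩).reachable
      · exact SimpleGraph.Reachable.trans hz' (show (openGraph (T ∩ E₂)).Adj z v by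
          rw [openGraph_adj]; exact ⟨⟨h, (hE₂ _).2 (Or.inr ⟨v, hv, Or.inr rfl⟩)⟩, fun h' => hzL (h' ▸ hv)⟩).reachable

/-- On `U` the pair `(X T, Y T)` depends only on `B T = {ℓ ∈ L : sℓ ∉ T}`. [this work] -/
theorem pair_eq (T : Set (Sym2 V)) (hT : z ∉ openCluster (Tᶜ ∩ E₂) s) (Φ : Set V → Set V → ℝ) :
    Φ (openCluster (T ∩ E₂) s) (openCluster (Tᶜ ∩ E₂) s) =
      Φ {v | v = s ∨ v = z ∨ v ∈ L} {v | v = s ∨ v ∈ L.filter (fun ℓ => s(s, ℓ) ∉ T)} := by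
  rw [X_eq E₂ s z L hsz hsL hzL hE₂ T hT, Y_eq E₂ s z L hsz hsL hzL hE₂ T hT]
  congr 1
  ext v
  simp only [Set.mem_setOf_eq, Finset.mem_filter]

variable [Fintype V]

/-- **Fibre count.**  For `B₀ ⊆ L`, the colourings `T ∈ U` with `B T = B₀` are exactly those containing the `|L| + 1` pairs
`sz`, `sℓ (ℓ ∉ B₀)`, `zℓ (ℓ ∈ B₀)` and avoiding the `|B₀|` pairs `sℓ (ℓ ∈ B₀)`; hence `|L| + 1 ≤ N − |B₀|` and there are
`2^{N − |B₀| − (|L|+1)}` of them (`N = |Sym2 V|`). [this work] -/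
theorem fibre_card (B₀ : Finset V) (hB₀ : B₀ ⊆ L) :
    L.card + 1 ≤ Fintype.card (Sym2 V) - B₀.card ∧
    ((Finset.univ : Finset (Set (Sym2 V))).filter (fun T =>
        z ∉ openCluster (Tᶜ ∩ E₂) s ∧ L.filter (fun ℓ => s(s, ℓ) ∉ T) = B₀)).card =
      2 ^ (Fintype.card (Sym2 V) - B₀.card - (L.card + 1)) := by
  -- the required and the forbidden pairs
  let A : Finset (Sym2 V) := insert s(s, z) (((L \ B₀).image fun ℓ => s(s, ℓ)) ∪ (B₀.image fun ℓ => s(z, ℓ)))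
  let D : Finset (Sym2 V) := B₀.image fun ℓ => s(s, ℓ)
  have hinj : ∀ c : V, Function.Injective (fun ℓ : V => s(c, ℓ)) := fun c a b h => by
    have h' : s(c, a) = s(c, b) := h
    rw [Sym2.eq_iff] at h'
    rcases h' with ⟨_, h⟩ | ⟨h1, h2⟩
    · exact h
    · rw [h2, ← h1]
  -- membership characterisation
  have hmem : ∀ T : Set (Sym2 V), (z ∉ openCluster (Tᶜ ∩ E₂) s ∧ L.filter (fun ℓ => s(s, ℓ) ∉ T) = B₀) ↔
      ((∀ e ∈ A, e ∈ T) ∧ ∀ e ∈ D, e ∉ T) := by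
    intro T
    rw [not_mem_Y_iff E₂ s z L hsz hsL hzL hE₂ T]
    constructor
    · rintro ⟨⟨hsz', hL⟩, hB⟩
      have hB' : ∀ ℓ, ℓ ∈ B₀ ↔ ℓ ∈ L ∧ s(s, ℓ) ∉ T := fun ℓ => by rw [← hB, Finset.mem_filter]
      refine ⟨fun e he => ?_, fun e he => ?_⟩
      · rcases Finset.mem_insert.1 he with rfl | he
        · exact hsz'
        · rcases Finset.mem_union.1 he with he | he
          · obtain ⟨ℓ, hℓ, rfl⟩ := Finset.mem_image.1 he
            obtain ⟨hℓL, hℓB⟩ := Finset.mem_sdiff.1 hℓ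
            by_contra h; exact hℓB ((hB' ℓ).2 ⟨hℓL, h⟩)
          · obtain ⟨ℓ, hℓ, rfl⟩ := Finset.mem_image.1 he
            obtain ⟨hℓL, hℓT⟩ := (hB' ℓ).1 hℓ
            exact (hL ℓ hℓL).resolve_left hℓT
      · obtain ⟨ℓ, hℓ, rfl⟩ := Finset.mem_image.1 he
        exact ((hB' ℓ).1 hℓ).2
    · rintro ⟨hA, hD⟩
      have hsz' : s(s, z) ∈ T := hA _ (Finset.mem_insert_self _ _)
      refine ⟨⟨hsz', fun ℓ hℓ => ?_⟩, ?_⟩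
      · by_cases hb : ℓ ∈ B₀
        · exact Or.inr (hA _ (Finset.mem_insert_of_mem (Finset.mem_union_right _ (Finset.mem_image_of_mem _ hb))))
        · exact Or.inl (hA _ (Finset.mem_insert_of_mem (Finset.mem_union_left _
            (Finset.mem_image_of_mem _ (Finset.mem_sdiff.2 ⟨hℓ, hb⟩)))))
      · ext ℓ
        rw [Finset.mem_filter]
        constructor
        · rintro ⟨hℓ, hT⟩
          by_contra hb
          exact hT (hA _ (Finset.mem_insert_of_mem (Finset.mem_union_left _
            (Finset.mem_image_of_mem _ (Finset.mem_sdiff.2 ⟨hℓ, hb⟩)))))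
        · intro hb
          exact ⟨hB₀ hb, hD _ (Finset.mem_image_of_mem _ hb)⟩
  -- `A` and `D` are disjoint; their sizes
  have hAD : A ⊆ Finset.univ \ D := by
    intro e he
    rw [Finset.mem_sdiff]
    refine ⟨Finset.mem_univ _, fun hD => ?_⟩
    obtain ⟨ℓ', hℓ', rfl⟩ := Finset.mem_image.1 hD
    have hℓ'L : ℓ' ∈ L := hB₀ hℓ'
    rcases Finset.mem_insert.1 he with h | h
    · -- s(s, ℓ') = s(s, z)
      have h2 := (hinj s) (show s(s, ℓ') = s(s, z) from h)
      exact hzL (h2 ▸ hℓ'L)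
    · rcases Finset.mem_union.1 h with h | h
      · obtain ⟨ℓ, hℓ, h⟩ := Finset.mem_image.1 h
        have h2 := (hinj s) h
        exact (Finset.mem_sdiff.1 hℓ).2 (h2 ▸ hℓ')
      · obtain ⟨ℓ, hℓ, h⟩ := Finset.mem_image.1 h
        rw [Sym2.eq_iff] at h
        rcases h with ⟨h1, _⟩ | ⟨h1, _⟩
        · exact hsz h1.symm
        · exact hzL (h1 ▸ hℓ'L)
  have hDcard : D.card = B₀.card := Finset.card_image_of_injective _ (hinj s)
  have hAcard : A.card = L.card + 1 := by
    have h1 : Disjoint ((L \ B₀).image fun ℓ => s(s, ℓ)) (B₀.image fun ℓ => s(z, ℓ)) := by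
      rw [Finset.disjoint_left]
      intro e he he'
      obtain ⟨ℓ, _, rfl⟩ := Finset.mem_image.1 he
      obtain ⟨ℓ', hℓ', h⟩ := Finset.mem_image.1 he'
      rw [Sym2.eq_iff] at h
      rcases h with ⟨h1, _⟩ | ⟨_, h2⟩
      · exact hsz h1.symm
      · exact hsL (hB₀ (h2 ▸ hℓ'))
    have h2 : s(s, z) ∉ ((L \ B₀).image fun ℓ => s(s, ℓ)) ∪ (B₀.image fun ℓ => s(z, ℓ)) := by
      intro h
      rcases Finset.mem_union.1 h with h | h
      · obtain ⟨ℓ, hℓ, h⟩ := Finset.mem_image.1 h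
        have h2 := (hinj s) h
        exact hzL (h2.symm ▸ (Finset.mem_sdiff.1 hℓ).1)
      · obtain ⟨ℓ, hℓ, h⟩ := Finset.mem_image.1 h
        rw [Sym2.eq_iff] at h
        rcases h with ⟨h1, _⟩ | ⟨_, h2⟩
        · exact hsz h1.symm
        · exact hsL (h2 ▸ hB₀ hℓ)
    show (insert s(s, z) (((L \ B₀).image fun ℓ => s(s, ℓ)) ∪ (B₀.image fun ℓ => s(z, ℓ)))).card = L.card + 1
    rw [Finset.card_insert_of_notMem h2, Finset.card_union_of_disjoint h1, Finset.card_image_of_injective _ (hinj s),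
      Finset.card_image_of_injective _ (hinj z), Finset.card_sdiff_add_card_eq_card hB₀]
  have hUDcard : (Finset.univ \ D).card = Fintype.card (Sym2 V) - B₀.card := by
    rw [Finset.card_sdiff, Finset.card_univ, Finset.inter_univ, hDcard]
  refine ⟨by rw [← hAcard, ← hUDcard]; exact Finset.card_le_card hAD, ?_⟩
  -- transport to `Finset (Sym2 V)` and count the interval `[A, univ ∖ D]`
  have hcount : ((Finset.univ : Finset (Set (Sym2 V))).filter (fun T =>
      z ∉ openCluster (Tᶜ ∩ E₂) s ∧ L.filter (fun ℓ => s(s, ℓ) ∉ T) = B₀)).card = (Finset.Icc A (Finset.univ \ D)).card := by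
    refine Finset.card_nbij' (fun T => Fintype.finsetEquivSet.symm T) (fun T' => (↑T' : Set (Sym2 V))) ?_ ?_ ?_ ?_
    · intro T hT
      have hT0 : z ∉ openCluster (Tᶜ ∩ E₂) s ∧ L.filter (fun ℓ => s(s, ℓ) ∉ T) = B₀ := by
        have := Finset.mem_coe.1 hT; exact (Finset.mem_filter.1 this).2
      have hT' := (hmem T).1 hT0
      have hmemT : ∀ e, e ∈ Fintype.finsetEquivSet.symm T ↔ e ∈ T := fun e => by
        have hc : ((Fintype.finsetEquivSet.symm T : Finset (Sym2 V)) : Set (Sym2 V)) = T := Fintype.finsetEquivSet.apply_symm_apply T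
        rw [← Finset.mem_coe, hc]
      rw [Finset.mem_coe, Finset.mem_Icc]
      refine ⟨fun e he => (hmemT e).2 (hT'.1 e he), fun e he => ?_⟩
      rw [Finset.mem_sdiff]
      exact ⟨Finset.mem_univ _, fun hD => hT'.2 e hD ((hmemT e).1 he)⟩
    · intro T' hT'
      rw [Finset.mem_coe, Finset.mem_Icc] at hT'
      have h : (∀ e ∈ A, e ∈ (↑T' : Set (Sym2 V))) ∧ ∀ e ∈ D, e ∉ (↑T' : Set (Sym2 V)) :=
        ⟨fun e he => hT'.1 he, fun e he heT => (Finset.mem_sdiff.1 (hT'.2 heT)).2 he⟩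
      rw [Finset.mem_coe, Finset.mem_filter]
      exact ⟨Finset.mem_univ _, (hmem _).2 h⟩
    · intro T _; exact Fintype.finsetEquivSet.apply_symm_apply T
    · intro T' _; exact Fintype.finsetEquivSet.symm_apply_apply T'
  rw [hcount, Finset.card_Icc_finset hAD, hUDcard, hAcard]

/-- **Reindexing the `U`-sum by the fibres of `B`.** [this work] -/
theorem sum_U_eq (f : Finset V → ℝ) :
    ∑ T ∈ (Finset.univ : Finset (Set (Sym2 V))).filter (fun T => z ∉ openCluster (Tᶜ ∩ E₂) s),
        f (L.filter (fun ℓ => s(s, ℓ) ∉ T)) =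
      ∑ B₀ ∈ L.powerset, (2 : ℝ) ^ (Fintype.card (Sym2 V) - B₀.card - (L.card + 1)) * f B₀ := by
  rw [← Finset.sum_fiberwise_of_maps_to (s := (Finset.univ : Finset (Set (Sym2 V))).filter (fun T => z ∉ openCluster (Tᶜ ∩ E₂) s))
    (t := L.powerset) (g := fun T => L.filter (fun ℓ => s(s, ℓ) ∉ T)) (fun T _ => Finset.mem_powerset.2 (Finset.filter_subset _ _))]
  refine Finset.sum_congr rfl fun B₀ hB₀ => ?_
  have hB₀' : B₀ ⊆ L := Finset.mem_powerset.1 hB₀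
  rw [Finset.filter_filter]
  have hc := (fibre_card E₂ s z L hsz hsL hzL hE₂ B₀ hB₀').2
  calc ∑ T ∈ Finset.univ.filter (fun T : Set (Sym2 V) => z ∉ openCluster (Tᶜ ∩ E₂) s ∧ L.filter (fun ℓ => s(s, ℓ) ∉ T) = B₀),
        f (L.filter (fun ℓ => s(s, ℓ) ∉ T))
      = ∑ T ∈ Finset.univ.filter (fun T : Set (Sym2 V) => z ∉ openCluster (Tᶜ ∩ E₂) s ∧ L.filter (fun ℓ => s(s, ℓ) ∉ T) = B₀), f B₀ :=
        Finset.sum_congr rfl fun T hT => by rw [(Finset.mem_filter.1 hT).2.2]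
    _ = _ := by rw [Finset.sum_const, nsmul_eq_mul, hc]; push_cast; ring

end Setting

/-- FKG on a finite distributive lattice for a log-supermodular weight and two MONOTONE real functions of any sign (Mathlib's `fkg` after a
shift). [folklore] -/
theorem fkg_real {α : Type*} [DistribLattice α] [Fintype α] (μ f g : α → ℝ) (hμ₀ : ∀ a, 0 ≤ μ a) (hf : Monotone f) (hg : Monotone g)
    (hμ : ∀ a b, μ a * μ b ≤ μ (a ⊓ b) * μ (a ⊔ b)) :
    (∑ a, μ a * f a) * (∑ a, μ a * g a) ≤ (∑ a, μ a) * ∑ a, μ a * (f a * g a) := by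
  set cf : ℝ := ∑ a, |f a| with hcf
  set cg : ℝ := ∑ a, |g a| with hcg
  have hsh : ∀ (k : α → ℝ) (a : α), 0 ≤ k a + ∑ b, |k b| := fun k a => by
    have h1 : |k a| ≤ ∑ b, |k b| := Finset.single_le_sum (f := fun a => |k a|) (fun b _ => abs_nonneg (k b)) (Finset.mem_univ a)
    linarith [neg_abs_le (k a)]
  have hf' : ∀ a, 0 ≤ f a + cf := fun a => hcf ▸ hsh f a
  have hg' : ∀ a, 0 ≤ g a + cg := fun a => hcg ▸ hsh g a
  have h := fkg (μ := μ) (f := fun a => f a + cf) (g := fun a => g a + cg) (fun a => hμ₀ a) (fun a => hf' a) (fun a => hg' a)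
    (fun a b hab => by simpa using hf hab) (fun a b hab => by simpa using hg hab) hμ
  have e0 : ∀ (k : α → ℝ) (c : ℝ), ∑ a, μ a * (k a + c) = ∑ a, μ a * k a + c * ∑ a, μ a := fun k c => by
    rw [Finset.mul_sum, ← Finset.sum_add_distrib]; exact Finset.sum_congr rfl fun a _ => by ring
  have e1 := e0 f cf
  have e2 := e0 g cg
  have e3 : ∑ a, μ a * ((f a + cf) * (g a + cg)) =
      ∑ a, μ a * (f a * g a) + cg * ∑ a, μ a * f a + cf * ∑ a, μ a * g a + cf * cg * ∑ a, μ a := by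
    rw [Finset.mul_sum, Finset.mul_sum, Finset.mul_sum, ← Finset.sum_add_distrib, ← Finset.sum_add_distrib, ← Finset.sum_add_distrib]
    exact Finset.sum_congr rfl fun a _ => by ring
  rw [e1, e2, e3] at h
  nlinarith [h]

/-- The same for two ANTITONE functions (order dual). [folklore] -/
theorem fkg_real_antitone {α : Type*} [DistribLattice α] [Fintype α] (μ f g : α → ℝ) (hμ₀ : ∀ a, 0 ≤ μ a) (hf : Antitone f)
    (hg : Antitone g) (hμ : ∀ a b, μ a * μ b ≤ μ (a ⊓ b) * μ (a ⊔ b)) :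
    (∑ a, μ a * f a) * (∑ a, μ a * g a) ≤ (∑ a, μ a) * ∑ a, μ a * (f a * g a) :=
  fkg_real (α := αᵒᵈ) (fun a => μ (OrderDual.ofDual a)) (fun a => f (OrderDual.ofDual a)) (fun a => g (OrderDual.ofDual a))
    (fun a => hμ₀ _) hf.dual_left hg.dual_left
    (fun a b => by
      show μ (OrderDual.ofDual a) * μ (OrderDual.ofDual b) ≤ μ (OrderDual.ofDual a ⊔ OrderDual.ofDual b) * μ (OrderDual.ofDual a ⊓ OrderDual.ofDual b)
      rw [mul_comm (μ (OrderDual.ofDual a ⊔ OrderDual.ofDual b))]; exact hμ _ _)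

section Main

variable [Fintype V] (E₂ : Set (Sym2 V)) (s z : V) (L : Finset V) (hsz : s ≠ z) (hsL : s ∉ L) (hzL : z ∉ L)
  (hE₂ : ∀ e, e ∈ E₂ ↔ e = s(s, z) ∨ ∃ ℓ ∈ L, e = s(s, ℓ) ∨ e = s(z, ℓ))
include hsz hsL hzL hE₂

/-- **The fan is R-associated** (hypothesis (H2) of THEOREM 2H, in the form of `Antithetic.TwoStage.change_nonneg`). [this work] -/
theorem R_associated (Φ₁ Φ₂ : Set V → Set V → ℝ)
    (hΦ₁ : ∀ ⦃A A' B B' : Set V⦄, A ⊆ A' → B' ⊆ B → Φ₁ A B ≤ Φ₁ A' B')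
    (hΦ₂ : ∀ ⦃A A' B B' : Set V⦄, A ⊆ A' → B' ⊆ B → Φ₂ A B ≤ Φ₂ A' B') :
    (∑ T ∈ Finset.univ.filter (fun T : Set (Sym2 V) => z ∉ openCluster (Tᶜ ∩ E₂) s),
        Φ₁ (openCluster (T ∩ E₂) s) (openCluster (Tᶜ ∩ E₂) s)) *
      (∑ T ∈ Finset.univ.filter (fun T : Set (Sym2 V) => z ∉ openCluster (Tᶜ ∩ E₂) s),
        Φ₂ (openCluster (T ∩ E₂) s) (openCluster (Tᶜ ∩ E₂) s)) ≤
    ((Finset.univ.filter fun T : Set (Sym2 V) => z ∉ openCluster (Tᶜ ∩ E₂) s).card : ℝ) *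
      ∑ T ∈ Finset.univ.filter (fun T : Set (Sym2 V) => z ∉ openCluster (Tᶜ ∩ E₂) s),
        Φ₁ (openCluster (T ∩ E₂) s) (openCluster (Tᶜ ∩ E₂) s) * Φ₂ (openCluster (T ∩ E₂) s) (openCluster (Tᶜ ∩ E₂) s) := by
  -- the pair as a function of `B T`
  let φ₁ : Finset V → ℝ := fun B₀ => Φ₁ {v | v = s ∨ v = z ∨ v ∈ L} {v | v = s ∨ v ∈ B₀}
  let φ₂ : Finset V → ℝ := fun B₀ => Φ₂ {v | v = s ∨ v = z ∨ v ∈ L} {v | v = s ∨ v ∈ B₀}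
  have hanti : ∀ {Φ : Set V → Set V → ℝ}, (∀ ⦃A A' B B' : Set V⦄, A ⊆ A' → B' ⊆ B → Φ A B ≤ Φ A' B') →
      Antitone (fun B₀ : Finset V => Φ {v | v = s ∨ v = z ∨ v ∈ L} {v | v = s ∨ v ∈ B₀}) := by
    intro Φ hΦ B₀ B₁ hB
    exact hΦ subset_rfl (fun v hv => hv.elim Or.inl (fun h => Or.inr (hB h)))
  set U := Finset.univ.filter (fun T : Set (Sym2 V) => z ∉ openCluster (Tᶜ ∩ E₂) s) with hUdef
  have hsum : ∀ (Φ : Set V → Set V → ℝ), ∑ T ∈ U, Φ (openCluster (T ∩ E₂) s) (openCluster (Tᶜ ∩ E₂) s) =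
      ∑ T ∈ U, Φ {v | v = s ∨ v = z ∨ v ∈ L} {v | v = s ∨ v ∈ L.filter (fun ℓ => s(s, ℓ) ∉ T)} := fun Φ =>
    Finset.sum_congr rfl fun T hT => pair_eq E₂ s z L hsz hsL hzL hE₂ T (Finset.mem_filter.1 hT).2 Φ
  -- the weight
  let w : Finset V → ℝ := fun B₀ => (2 : ℝ) ^ (Fintype.card (Sym2 V) - B₀.card - (L.card + 1))
  let μ : Finset V → ℝ := fun B₀ => if B₀ ⊆ L then w B₀ else 0
  have hμ₀ : ∀ B₀, 0 ≤ μ B₀ := fun B₀ => by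
    show 0 ≤ (if B₀ ⊆ L then w B₀ else 0)
    split_ifs
    · positivity
    · exact le_rfl
  have hμsum : ∀ f : Finset V → ℝ, ∑ B₀ ∈ L.powerset, w B₀ * f B₀ = ∑ B₀, μ B₀ * f B₀ := by
    intro f
    have hpow : L.powerset = Finset.univ.filter (fun B₀ : Finset V => B₀ ⊆ L) := by
      ext B₀; simp only [Finset.mem_powerset, Finset.mem_filter, Finset.mem_univ, true_and]
    rw [hpow, Finset.sum_filter]
    refine Finset.sum_congr rfl fun B₀ _ => ?_
    show (if B₀ ⊆ L then w B₀ * f B₀ else 0) = (if B₀ ⊆ L then w B₀ else 0) * f B₀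
    split_ifs <;> simp
  -- log-supermodularity of the weight
  have hμlat : ∀ B B' : Finset V, μ B * μ B' ≤ μ (B ⊓ B') * μ (B ⊔ B') := by
    intro B B'
    show (if B ⊆ L then w B else 0) * (if B' ⊆ L then w B' else 0) ≤
      (if B ∩ B' ⊆ L then w (B ∩ B') else 0) * (if B ∪ B' ⊆ L then w (B ∪ B') else 0)
    by_cases hB : B ⊆ L
    · by_cases hB' : B' ⊆ L
      · have hi : B ∩ B' ⊆ L := fun v hv => hB (Finset.mem_inter.1 hv).1
        have hu : B ∪ B' ⊆ L := Finset.union_subset hB hB'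
        rw [if_pos hB, if_pos hB', if_pos hi, if_pos hu]
        have e1 := (fibre_card E₂ s z L hsz hsL hzL hE₂ B hB).1
        have e2 := (fibre_card E₂ s z L hsz hsL hzL hE₂ B' hB').1
        have e3 := (fibre_card E₂ s z L hsz hsL hzL hE₂ _ hi).1
        have e4 := (fibre_card E₂ s z L hsz hsL hzL hE₂ _ hu).1
        have e5 := Finset.card_union_add_card_inter B B'
        have hexp : (Fintype.card (Sym2 V) - B.card - (L.card + 1)) + (Fintype.card (Sym2 V) - B'.card - (L.card + 1)) =
            (Fintype.card (Sym2 V) - (B ∩ B').card - (L.card + 1)) + (Fintype.card (Sym2 V) - (B ∪ B').card - (L.card + 1)) := by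
          omega
        show (2 : ℝ) ^ _ * (2 : ℝ) ^ _ ≤ (2 : ℝ) ^ _ * (2 : ℝ) ^ _
        rw [← pow_add, ← pow_add, hexp]
      · rw [if_neg hB']; simp only [mul_zero]; exact mul_nonneg (hμ₀ _) (hμ₀ _)
    · rw [if_neg hB]; simp only [zero_mul]; exact mul_nonneg (hμ₀ _) (hμ₀ _)
  -- rewrite the three sums and the cardinality through the fibres
  have hS : ∀ {Φ : Set V → Set V → ℝ}, ∑ T ∈ U, Φ (openCluster (T ∩ E₂) s) (openCluster (Tᶜ ∩ E₂) s) =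
      ∑ B₀, μ B₀ * Φ {v | v = s ∨ v = z ∨ v ∈ L} {v | v = s ∨ v ∈ B₀} := by
    intro Φ
    rw [hsum Φ, hUdef, sum_U_eq E₂ s z L hsz hsL hzL hE₂ (fun B₀ => Φ {v | v = s ∨ v = z ∨ v ∈ L} {v | v = s ∨ v ∈ B₀}), hμsum]
  have hcard : (U.card : ℝ) = ∑ B₀, μ B₀ := by
    have h1 : (U.card : ℝ) = ∑ T ∈ U, (fun _ : Finset V => (1 : ℝ)) (L.filter (fun ℓ => s(s, ℓ) ∉ T)) := by
      rw [Finset.sum_const, nsmul_eq_mul, mul_one]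
    rw [h1, hUdef, sum_U_eq E₂ s z L hsz hsL hzL hE₂ (fun _ => (1 : ℝ)), hμsum]
    simp only [mul_one]
  have hprod : ∑ T ∈ U, Φ₁ (openCluster (T ∩ E₂) s) (openCluster (Tᶜ ∩ E₂) s) * Φ₂ (openCluster (T ∩ E₂) s) (openCluster (Tᶜ ∩ E₂) s) =
      ∑ B₀, μ B₀ * (φ₁ B₀ * φ₂ B₀) :=
    hS (Φ := fun A B => Φ₁ A B * Φ₂ A B)
  rw [hS (Φ := Φ₁), hS (Φ := Φ₂), hcard, hprod]
  exact fkg_real_antitone μ φ₁ φ₂ hμ₀ (hanti hΦ₁) (hanti hΦ₂) hμlat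

end Main

end Fan

end TwoStage

end Antithetic

end Summit.CriticalPhenomena.PercolationContinuityZ3.Theorems
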